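import Summits.QuantumAdvantage.QuantumAdvantage.Theorems.SosSandwichRandomOracleHeurSeparationDefs
import Summits.QuantumAdvantage.QuantumAdvantage.Theorems.SosSandwichRandomOracleHeurSeparationHeurEvents
import Literature.Computability.Complexity.BPPErrorReduction
import Literature.Computability.Complexity.BPPSubsetAlmostP
import Literature.Computability.Complexity.NondeterministicProofs
import Literature.Computability.Complexity.StringCopy
import Literature.Computability.Complexity.CoinTruncation

/-!
# Crux `RandomOracleHeurSeparation` (stmt-QuantumAdvantage-1131, route SosSandwich), line `birth` —
# stub `stub_almostAvgP_heur`, part 2: the heuristic algorithm; ALMOST-`AvgP ⊆ ⋂_{δ>0} Heur_δBPP`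

Registered signature: `theorem stub_almostAvgP_heur : ∀ L : Language Bool, L ∈ almostAvgP → HeurConstBPP L`
(vocabulary from `Theorems/SosSandwichRandomOracleHeurSeparationDefs.lean`, same namespace as the skeleton
`Cruxes/RandomOracleHeurSeparation/Lines/birth.lean`). Average-case Bennett–Gill:

* §5 the WITNESS LANGUAGE `witLang` — the table of `L` on the
  inputs shorter than `N₀`, and from `N₀` on the lazy-sampling simulation of the capped machine `M` with
  the cylinder table `τ` hard-wired (`lazySamplingSimulatorInP_holds`: in `P`); the heuristic algorithm
  `heurAlg` = lift of the (coin-truncated) witness algorithm of `witLang`, probabilistic polynomial time,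
  with error probability `0` on short inputs and `≤ Pr_coins[simulation ≠ [x ∈ L]]` on long ones.
* §6 `mem_HeurDeltaBPP_of_good_pos` — density cylinder (`exists_oracleCylinder_inter_ge`) with
  `η = min(δ/12, 1/4)`, continuity from below along the tails (`tendsto_measure_iUnion_atTop`) for a
  length `N₀`, the counting bound of part 1 and Markov over the `2ⁿ` inputs: at every length the inputs
  with coin-error `≥ 1/4` are a `≤ 12η ≤ δ` fraction; the stub follows with part 1's pigeonhole.

Sources: BennettGill1981 Thm. 5; BookVollmerWagner1996 §3 Prop. 1–2 and §4 Thm. 3 (p. 374);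
AaronsonAmbainis2014 §1 p. 5 and Thm. 7 (iii); BogdanovTrevisan2006 Def. 2.13; AroraBarak2009 §7.1.
-/

-- D-0017: single-conjunct summit ⇒ the duplicate `QuantumAdvantage.QuantumAdvantage` is mandated.
set_option linter.dupNamespace false

noncomputable section

namespace Summit.QuantumAdvantage.QuantumAdvantage.Cruxes.RandomOracleHeurSeparation.Birth

open MeasureTheory Filter Finset
open Literature.Computability.Complexity Literature.Computability.Complexity.OracleAlg
open Literature.Computability.QuantumComplexity
open Literature.Computability.MetaComplexity (HeurDeltaBPP uniformEnsemble DistProblem paramEnc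
  prob_uniformEnsemble Ensemble)
open scoped ENNReal

namespace StubAlmostAvgPHeur


/-! ### §5 The hard-wired witness language and the heuristic algorithm -/

section Algorithm

variable (L : Language Bool) (M : OracleAlg Bool) (q : Polynomial ℕ) (U : Finset (List Bool))
  (τ : U → Bool) (N₀ : ℕ)

/-- The lazy-sampling language of `M` with the table `τ` hard-wired: the pairs `⟨x, y⟩` on which the
simulation of `M` on `x` with coins `y` accepts within `q(|x|)` rounds. [cite: BookVollmerWagner1996, §3 Prop. 1–2] -/
def lazyLang : Language Bool :=
  {w : List Bool | runWith M (boolUnpair w).1 (coinAns M U τ (boolUnpair w).1 (boolUnpair w).2)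
    (q.eval (boolUnpair w).1.length) [] = some true}

/-- The short part: `⟨x, y⟩` with `|x| < N₀` and `x ∈ L` (the hard-wired table of `L`). [folklore] -/
def shortLang : Language Bool :=
  {w : List Bool | (boolUnpair w).1 ∈ ({x | x ∈ L ∧ x.length < N₀} : Language Bool)}

/-- The long part: `⟨x, y⟩` with `N₀ ≤ |x|`. [folklore] -/
def longLang : Language Bool :=
  {w : List Bool | (boolUnpair w).1 ∈ ({x | N₀ ≤ x.length} : Language Bool)}

/-- **The witness language**: the table of `L` below length `N₀`, the lazy-sampling simulation from
`N₀` on. [folklore] -/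
def witLang : Language Bool :=
  shortLang L N₀ ⊔ (longLang N₀ ⊓ lazyLang M q U τ)

/-- Membership of a pair in the witness language, unfolded. [folklore] -/
theorem boolPair_mem_witLang_iff (x y : List Bool) :
    boolPair x y ∈ witLang L M q U τ N₀ ↔
      (x ∈ L ∧ x.length < N₀) ∨
        (N₀ ≤ x.length ∧ runWith M x (coinAns M U τ x y) (q.eval x.length) [] = some true) := by
  change ((boolUnpair (boolPair x y)).1 ∈ L ∧ (boolUnpair (boolPair x y)).1.length < N₀) ∨
      (N₀ ≤ (boolUnpair (boolPair x y)).1.length ∧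
        runWith M (boolUnpair (boolPair x y)).1
            (coinAns M U τ (boolUnpair (boolPair x y)).1 (boolUnpair (boolPair x y)).2)
            (q.eval (boolUnpair (boolPair x y)).1.length) [] = some true) ↔ _
  simp only [boolUnpair_boolPair]

/-- Membership of a pair in the witness language, short inputs. [folklore] -/
theorem boolPair_mem_witLang_of_lt {x : List Bool} (hx : x.length < N₀) (y : List Bool) :
    boolPair x y ∈ witLang L M q U τ N₀ ↔ x ∈ L := by
  rw [boolPair_mem_witLang_iff]
  constructor
  · rintro (⟨h, -⟩ | ⟨h, -⟩)
    · exact h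
    · omega
  · exact fun h => Or.inl ⟨h, hx⟩

/-- Membership of a pair in the witness language, long inputs. [folklore] -/
theorem boolPair_mem_witLang_of_le {x : List Bool} (hx : N₀ ≤ x.length) (y : List Bool) :
    boolPair x y ∈ witLang L M q U τ N₀ ↔
      runWith M x (coinAns M U τ x y) (q.eval x.length) [] = some true := by
  rw [boolPair_mem_witLang_iff]
  constructor
  · rintro (⟨-, h⟩ | ⟨-, h⟩)
    · omega
    · exact h
  · exact fun h => Or.inr ⟨hx, h⟩

/-- **The witness language is in `P`** when `M` is a polynomial-time machine whose queries have length
`≤ q(|x|)`: the lazy-sampling simulator runs in polynomial time (`lazySamplingSimulatorInP_holds`), the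
short and long parts are a finite patch and a length test, and `P` is closed under `∩`, `∪` and the first
projection of pairs. [cite: BookVollmerWagner1996, §3 Prop. 1–2 (p. 373–374)] -/
theorem witLang_mem_P (hM : M.IsPolyTime Computability.encodingBoolBool)
    (hcap : ∀ (x : List Bool) (as : List (List Bool)) (u : List Bool),
      M.step x as = Sum.inl u → u.length ≤ q.eval x.length) :
    witLang L M q U τ N₀ ∈ Classes.P := by
  have hlazy : lazyLang M q U τ ∈ Classes.P := lazySamplingSimulatorInP_holds M q hM hcap U τ q
  have hshort : shortLang L N₀ ∈ Classes.P := P_closed_boolUnpair_fst _ (shortPart_mem_P L N₀)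
  have hlong : longLang N₀ ∈ Classes.P := P_closed_boolUnpair_fst _ (setOf_le_length_mem_P N₀)
  exact union_mem_P hshort (inter_mem_P hlong hlazy)

/-- **The heuristic algorithm** on parametrised inputs `(x, 1ⁿ)`: the witness algorithm of the witness
language with coin budget `q` (coins truncated to the budget), the parameter ignored. [folklore] -/
def heurAlg : RandAlg (List Bool × ℕ) Bool :=
  paramLift ((witnessAlg (witLang L M q U τ N₀) q).truncate id)

/-- The heuristic algorithm is probabilistic polynomial time when the witness language is in `P`. [folklore] -/
theorem heurAlg_isPolyTime (h : witLang L M q U τ N₀ ∈ Classes.P) :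
    (heurAlg L M q U τ N₀).IsPolyTime paramEnc Computability.encodeBool :=
  isPolyTime_paramLift
    ((witnessAlg_isPolyTime h q).truncate polyTimeComputable_boolPair_take_holds ⟨q, fun _ => rfl⟩)

/-- The error probability of the heuristic algorithm on `(x, 1ⁿ)` is the counting probability of the
wrong-verdict event of the witness language at `x`. [folklore] -/
theorem heurAlg_pr_ne (x : List Bool) (n : ℕ) :
    (heurAlg L M q U τ N₀).pr paramEnc (x, n) {b | b ≠ L.boolIndicator x} =
      uniformProb (q.eval x.length) {y : List Bool | ¬ (boolPair x y ∈ witLang L M q U τ N₀ ↔ x ∈ L)} := by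
  unfold heurAlg
  rw [pr_paramLift _ ⟨q, fun _ => rfl⟩
      (fun x r => (RandAlg.truncate_run_take (witnessAlg (witLang L M q U τ N₀) q) id x r).symm),
    RandAlg.pr_truncate, witnessAlg_pr_ne]

/-- On short inputs the algorithm is always right. [folklore] -/
theorem heurAlg_pr_ne_of_lt {x : List Bool} (hx : x.length < N₀) (n : ℕ) :
    (heurAlg L M q U τ N₀).pr paramEnc (x, n) {b | b ≠ L.boolIndicator x} = 0 := by
  rw [heurAlg_pr_ne]
  have hempty : {y : List Bool | ¬ (boolPair x y ∈ witLang L M q U τ N₀ ↔ x ∈ L)} = ∅ :=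
    Set.eq_empty_of_forall_notMem fun y hy => hy (boolPair_mem_witLang_of_lt L M q U τ N₀ hx y)
  rw [hempty, uniformProb_empty]

/-- On long inputs the error probability is at most the probability that the simulation does not output
`[x ∈ L]`. [folklore] -/
theorem heurAlg_pr_ne_le_of_le {x : List Bool} (hx : N₀ ≤ x.length) (n : ℕ) :
    (heurAlg L M q U τ N₀).pr paramEnc (x, n) {b | b ≠ L.boolIndicator x} ≤
      uniformProb (q.eval x.length)
        {y : List Bool | runWith M x (coinAns M U τ x y) (q.eval x.length) [] ≠ some (L.boolIndicator x)} := by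
  rw [heurAlg_pr_ne]
  refine PromiseCook.uniformProb_mono fun y hy => ?_
  simp only [Set.mem_setOf_eq] at hy ⊢
  intro hrun
  apply hy
  rw [boolPair_mem_witLang_of_le L M q U τ N₀ hx y, hrun]
  by_cases hxL : x ∈ L
  · rw [(Set.mem_iff_boolIndicator _ _).1 hxL]
    exact ⟨fun _ => hxL, fun _ => rfl⟩
  · rw [(Set.notMem_iff_boolIndicator _ _).1 hxL]
    constructor
    · intro h; cases h
    · intro h; exact absurd h hxL

end Algorithm

/-! ### §6 Assembly: the good event of positive measure gives `Heur_δBPP` for every `δ > 0` -/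

/-- **Steps 3–5 (density, continuity from below, counting).** If the good event of a polynomial-time
capped machine has positive measure, then for every `δ > 0` the language is heuristically decidable on the
uniform ensemble with failure rate `δ`. [cite: BookVollmerWagner1996, §4 Thm. 3 (p. 374)]
[cite: BogdanovTrevisan2006, Def. 2.13] -/
theorem mem_HeurDeltaBPP_of_good_pos {L : Language Bool} {M : OracleAlg Bool} {q : Polynomial ℕ}
    (hM : M.IsPolyTime Computability.encodingBoolBool)
    (hcap : ∀ (x : List Bool) (as : List (List Bool)) (u : List Bool),
      M.step x as = Sum.inl u → u.length ≤ q.eval x.length)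
    (hpos : randomOracleMeasure (good L M q) ≠ 0) {δ : ℝ} (hδ : 0 < δ) :
    (⟨L, uniformEnsemble⟩ : DistProblem) ∈ HeurDeltaBPP (fun _ => δ) := by
  classical
  -- constants: η₀ = min (δ/12) (1/4), k with 1/(k+1) ≤ η₀
  set η₀ : ℝ := min (δ / 12) (1 / 4) with hη₀def
  have hη₀pos : 0 < η₀ := lt_min (by positivity) (by norm_num)
  have hη₀le : η₀ ≤ δ / 12 := min_le_left _ _
  have hη₀lt : η₀ < 1 := (min_le_right _ _).trans_lt (by norm_num)
  set k : ℕ := ⌈1 / η₀⌉₊ with hkdef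
  set c : ℝ := 1 / ((k : ℝ) + 1) with hcdef
  have hcpos : 0 < c := by positivity
  have hcle : c ≤ η₀ := by
    rw [hcdef, div_le_iff₀ (by positivity)]
    have h1 : 1 / η₀ ≤ (k : ℝ) := Nat.le_ceil _
    have h2 : 1 ≤ η₀ * (k : ℝ) := by
      have := mul_le_mul_of_nonneg_left h1 hη₀pos.le
      rwa [mul_one_div_cancel hη₀pos.ne'] at this
    nlinarith
  -- the measure, in real form
  set μ := randomOracleMeasure with hμ
  -- Step 3: density
  have hη : ENNReal.ofReal η₀ ≠ 0 := by
    rw [ne_eq, ENNReal.ofReal_eq_zero, not_le]; exact hη₀pos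
  obtain ⟨U, τ, hdens⟩ := exists_oracleCylinder_inter_ge (measurableSet_good L M q) hpos hη
  set cyl := oracleCylinder U τ with hcyl
  have hcyl0 : μ cyl ≠ 0 := measure_oracleCylinder_ne_zero U τ
  have hcyltop : μ cyl ≠ ⊤ := measure_oracleCylinder_ne_top U τ
  have hmpos : 0 < μ.real cyl := ENNReal.toReal_pos hcyl0 hcyltop
  have hdensR : (1 - η₀) * μ.real cyl ≤ μ.real (good L M q ∩ cyl) := by
    have h := ENNReal.toReal_mono (measure_ne_top _ _) hdens
    rw [ENNReal.toReal_mul, ENNReal.toReal_sub_of_le (ENNReal.ofReal_le_one.2 hη₀lt.le) ENNReal.one_ne_top,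
      ENNReal.toReal_one, ENNReal.toReal_ofReal hη₀pos.le] at h
    simpa only [measureReal_def] using h
  -- Step 4: continuity from below along the tails for the exponent k
  set s : ℕ → Set (Set (List Bool)) := fun N => tail L M q c N ∩ cyl with hs
  have hsmono : Monotone s := fun N N' h => Set.inter_subset_inter_left _ (tail_mono L M q c h)
  have hlim : Tendsto (fun N => μ.real (s N)) atTop (nhds (μ.real (⋃ N, s N))) := by
    have h := tendsto_measure_iUnion_atTop (μ := μ) hsmono
    have h2 := (ENNReal.tendsto_toReal (measure_ne_top μ (⋃ N, s N))).comp h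
    simpa only [measureReal_def, Function.comp_def] using h2
  have hcover : good L M q ∩ cyl ⊆ ⋃ N, s N := by
    rintro A ⟨hA, hAc⟩
    have hk := Set.mem_iInter.1 hA k
    obtain ⟨N, hN⟩ := Set.mem_iUnion.1 hk
    exact Set.mem_iUnion.2 ⟨N, hN, hAc⟩
  have hlimge : (1 - η₀) * μ.real cyl ≤ μ.real (⋃ N, s N) :=
    hdensR.trans (measureReal_mono hcover)
  have hε : 0 < η₀ * μ.real cyl := mul_pos hη₀pos hmpos
  obtain ⟨N₀, hN₀⟩ := Metric.tendsto_atTop.1 hlim _ hε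
  have hsN₀ : (1 - 2 * η₀) * μ.real cyl ≤ μ.real (s N₀) := by
    have h := hN₀ N₀ le_rfl
    rw [Real.dist_eq, abs_lt] at h
    nlinarith [h.1]
  -- the measure of the cylinder outside the tail
  have htailmeas : MeasurableSet (tail L M q c N₀) := measurableSet_tail L M q c N₀
  have hout : μ.real (cyl \ tail L M q c N₀) ≤ 2 * η₀ * μ.real cyl := by
    have hsplit := measureReal_inter_add_sdiff (μ := μ) (s := cyl) htailmeas
    have h1 : μ.real (cyl ∩ tail L M q c N₀) = μ.real (s N₀) := by rw [hs, Set.inter_comm]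
    nlinarith [hsplit, h1, hsN₀]
  -- Step 5: the algorithm
  refine ⟨heurAlg L M q U τ N₀, heurAlg_isPolyTime L M q U τ N₀ (witLang_mem_P L M q U τ N₀ hM hcap),
    fun n => ?_⟩
  change uniformEnsemble.prob n
      {x | (1 : ℝ) / 4 ≤ (heurAlg L M q U τ N₀).pr paramEnc (x, n) {b | b ≠ L.boolIndicator x}} ≤ δ
  rw [prob_uniformEnsemble]
  unfold uniformProb
  rw [div_le_iff₀ (by positivity)]
  -- counting over the inputs of length `n`, for an arbitrary decidability instance of the bad predicate
  have hcount : ∀ (P : List.Vector Bool n → Prop) (inst : DecidablePred P) (T : Finset (List.Vector Bool n)),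
      (∀ r, P r → r ∈ T) → ((@Finset.filter _ P inst Finset.univ).card : ℝ) ≤ T.card := by
    intro P inst T hP
    exact_mod_cast Finset.card_le_card fun r hr => hP r (Finset.mem_filter.1 hr).2
  by_cases hn : n < N₀
  · -- short inputs: no bad input at all
    refine (hcount _ _ ∅ fun r hr => ?_).trans ?_
    · have hlen : r.toList.length < N₀ := by rw [List.Vector.toList_length]; exact hn
      have hr' : (1 : ℝ) / 4 ≤ (heurAlg L M q U τ N₀).pr paramEnc (r.toList, n)
          {b | b ≠ L.boolIndicator r.toList} := hr
      rw [heurAlg_pr_ne_of_lt L M q U τ N₀ hlen] at hr'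
      norm_num at hr'
    · rw [Finset.card_empty, Nat.cast_zero]
      exact mul_nonneg hδ.le (by positivity)
  · -- long inputs: Markov over the inputs against the counting bound of part 1
    push Not at hn
    have h2n : (0 : ℝ) ≤ 2 ^ n := by positivity
    -- (a) total measure of the wrong-answer events inside the cylinder
    have hsum_tail : ∑ v : List.Vector Bool n, μ.real (wrongAt L M q v.toList ∩ s N₀) ≤
        2 ^ n * c * μ.real (s N₀) :=
      sum_measureReal_wrongAt_inter_le L M q (htailmeas.inter (measurableSet_oracleCylinder U τ))
        hcpos.le fun A hA => hA.1 n hn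
    have hsplit : ∀ v : List.Vector Bool n, μ.real (wrongAt L M q v.toList ∩ cyl) ≤
        μ.real (wrongAt L M q v.toList ∩ s N₀) + μ.real (cyl \ tail L M q c N₀) := by
      intro v
      calc μ.real (wrongAt L M q v.toList ∩ cyl)
          ≤ μ.real (wrongAt L M q v.toList ∩ s N₀ ∪ cyl \ tail L M q c N₀) := by
            refine measureReal_mono fun A hA => ?_
            by_cases ht : A ∈ tail L M q c N₀
            · exact Or.inl ⟨hA.1, ht, hA.2⟩
            · exact Or.inr ⟨hA.2, ht⟩
        _ ≤ μ.real (wrongAt L M q v.toList ∩ s N₀) + μ.real (cyl \ tail L M q c N₀) :=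
            measureReal_union_le _ _
    have hsN₀le : μ.real (s N₀) ≤ μ.real cyl := measureReal_mono Set.inter_subset_right
    have hsum : ∑ v : List.Vector Bool n, μ.real (wrongAt L M q v.toList ∩ cyl) ≤
        2 ^ n * (c + 2 * η₀) * μ.real cyl := by
      have h1 : 2 ^ n * c * μ.real (s N₀) ≤ 2 ^ n * c * μ.real cyl :=
        mul_le_mul_of_nonneg_left hsN₀le (mul_nonneg h2n hcpos.le)
      have h2 : (2 : ℝ) ^ n * μ.real (cyl \ tail L M q c N₀) ≤ 2 ^ n * (2 * η₀ * μ.real cyl) :=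
        mul_le_mul_of_nonneg_left hout h2n
      calc ∑ v : List.Vector Bool n, μ.real (wrongAt L M q v.toList ∩ cyl)
          ≤ ∑ v : List.Vector Bool n,
              (μ.real (wrongAt L M q v.toList ∩ s N₀) + μ.real (cyl \ tail L M q c N₀)) :=
            Finset.sum_le_sum fun v _ => hsplit v
        _ = (∑ v : List.Vector Bool n, μ.real (wrongAt L M q v.toList ∩ s N₀)) +
              2 ^ n * μ.real (cyl \ tail L M q c N₀) := by
            rw [Finset.sum_add_distrib, Finset.sum_const, Finset.card_univ, card_vector, Fintype.card_bool,
              nsmul_eq_mul]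
            push_cast
            ring
        _ ≤ 2 ^ n * c * μ.real cyl + 2 ^ n * (2 * η₀ * μ.real cyl) := by linarith [hsum_tail, h1, h2]
        _ = 2 ^ n * (c + 2 * η₀) * μ.real cyl := by ring
    -- (b) the bad inputs are among those with `μ cyl ≤ 4 μ (wrong ∩ cyl)`
    set Bad := Finset.univ.filter fun v : List.Vector Bool n =>
      μ.real cyl ≤ 4 * μ.real (wrongAt L M q v.toList ∩ cyl) with hBad
    have hBadcard : (Bad.card : ℝ) * μ.real cyl ≤ 4 * (2 ^ n * (c + 2 * η₀) * μ.real cyl) := by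
      calc (Bad.card : ℝ) * μ.real cyl = ∑ _v ∈ Bad, μ.real cyl := by
            rw [Finset.sum_const, nsmul_eq_mul]
        _ ≤ ∑ v ∈ Bad, 4 * μ.real (wrongAt L M q v.toList ∩ cyl) :=
            Finset.sum_le_sum fun v hv => (Finset.mem_filter.1 hv).2
        _ ≤ ∑ v : List.Vector Bool n, 4 * μ.real (wrongAt L M q v.toList ∩ cyl) :=
            Finset.sum_le_sum_of_subset_of_nonneg (Finset.filter_subset _ _)
              fun v _ _ => by positivity
        _ = 4 * ∑ v : List.Vector Bool n, μ.real (wrongAt L M q v.toList ∩ cyl) := by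
            rw [Finset.mul_sum]
        _ ≤ 4 * (2 ^ n * (c + 2 * η₀) * μ.real cyl) := by linarith [hsum]
    have hBadle : (Bad.card : ℝ) ≤ 4 * (2 ^ n * (c + 2 * η₀)) :=
      le_of_mul_le_mul_right (by linarith [hBadcard]) hmpos
    refine (hcount _ _ Bad fun v hv => ?_).trans ?_
    · -- a bad input (coin error ≥ 1/4) has conditional wrong-measure ≥ 1/4
      have hlen : N₀ ≤ v.toList.length := by rw [List.Vector.toList_length]; exact hn
      have hv' : (1 : ℝ) / 4 ≤ (heurAlg L M q U τ N₀).pr paramEnc (v.toList, n)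
          {b | b ≠ L.boolIndicator v.toList} := hv
      have h2 := hv'.trans (heurAlg_pr_ne_le_of_le L M q U τ N₀ hlen n)
      have h3 := uniformProb_ne_mul_measureReal M v.toList (q.eval v.toList.length) U τ
        (L.boolIndicator v.toList)
      have h4 : μ.real (wrongAt L M q v.toList ∩ cyl) =
          uniformProb (q.eval v.toList.length)
            {y : List Bool | runWith M v.toList (coinAns M U τ v.toList y) (q.eval v.toList.length) [] ≠
              some (L.boolIndicator v.toList)} * μ.real cyl := h3.symm
      rw [hBad, Finset.mem_filter]
      refine ⟨Finset.mem_univ _, ?_⟩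
      rw [h4]
      nlinarith [h2, hmpos]
    · calc (Bad.card : ℝ) ≤ 4 * (2 ^ n * (c + 2 * η₀)) := hBadle
        _ ≤ δ * 2 ^ n := by
            have h12 : 4 * (c + 2 * η₀) ≤ δ := by linarith [hcle, hη₀le]
            nlinarith [h12, h2n]

end StubAlmostAvgPHeur

open StubAlmostAvgPHeur in
/-- **Stub `stub_almostAvgP_heur` of line `birth`** (registered signature
`∀ L : Language Bool, L ∈ almostAvgP → HeurConstBPP L`): ALMOST-`AvgP ⊆ ⋂_{δ>0} Heur_δBPP` on the uniform
ensemble — the average-case form of Bennett–Gill's random-oracle mechanism. If `L ∈ AvgP^A` for almost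
every oracle `A`, then some polynomial-time machine `M` with budget `q` has error fraction `→ 0` on a set of
oracles of positive measure (countable pigeonhole); capping its queries, Lebesgue density gives a cylinder
`τ` in which the (measurable) good event has conditional measure `≥ 1 − η`; continuity from below gives a
length `N₀` beyond which the error fraction is `≤ η` off a `2η`-fraction of the cylinder; integrating the
count of wrong answers and Markov over the `2ⁿ` inputs bounds by `12η·2ⁿ` the inputs on which `M^A` is
wrong with conditional probability `≥ 1/4`; by the lazy-sampling identity that conditional probability IS
the coin-error of the polynomial-time simulation of `M` (table `τ` hard-wired, fresh coins for fresh
queries), and the finitely many short lengths are hard-wired. [cite: BennettGill1981, Thm. 5]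
[cite: BookVollmerWagner1996, §4 Thm. 3 (p. 374) and §3 Prop. 1–2] [cite: BogdanovTrevisan2006, Def. 2.13] -/
theorem stub_almostAvgP_heur : ∀ L : Language Bool, L ∈ almostAvgP → HeurConstBPP L := by
  intro L hL δ hδ
  obtain ⟨M, q, hM, hpos⟩ := exists_machine_pos hL
  have hpos' : randomOracleMeasure (good L (M.capQ q false) q) ≠ 0 :=
    fun h => hpos (measure_mono_null (wit_subset_good L M q) h)
  exact mem_HeurDeltaBPP_of_good_pos (isPolyTime_capQ (eb := Computability.encodingBoolBool) hM q false)
    (fun x as u h => capQ_step_eq_inl h) hpos' hδ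

end Summit.QuantumAdvantage.QuantumAdvantage.Cruxes.RandomOracleHeurSeparation.Birth

end
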